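import Summits.CriticalPhenomena.PercolationContinuityZ3.Theorems.Transplant.FKDoubleFanWordCellsWFree
import HarnessLib

/-!
# Double fans `K₂ ∨ P_{m+1}`: the generator rows and columns `A` and `D` of EVERY rim word are free (`q ∈ [0,1]`, all spokes)

Helper file (`--supports stmt-CriticalPhenomena-4575`), FK sub-lane `prim-bschramm-fk-3` (gen 50); builds on p205010 (kernel theorem, internal
audit signed; external expert review pending).  No named facts, no sorries, default heartbeats; standard axioms.  Memo
`bschramm/prim-bschramm-fk-3/FAR-CROSS-XXV.md` §2.

`…WordCellsWFree` disposed of the 19 rim words with a `W_D` letter.  For the remaining `T/I` words the parts condition `PartsOK` asks for 49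
polynomial inequalities, one per pair of generators `(P,S) ∈ {A, D, AC, BD, 𝟙, R₀(w), R₁(w)}²`.  This file removes the rows and columns of
`A` and `D` for EVERY word (all `k0 k1 k2`, not only `T/I`) and every two-block spoke pattern, uniformly in `q ∈ [0,1]`:
* the input bivector of `D` is the seed `e_zv = bivZV` of the seed cone (**`inputBiv_rayD`**), so the whole word applied to it stays in the cone
  and pairs `≥ 0` with every target generator (**`pcell2_rayD_nonneg`**);
* the input bivector of `A` spans the one-dimensional channel `∧²V₂ = ℝ·e_xv`, on which every letter acts by a non-negative scalar
  (**`rimOp_xvRay`**, **`opAC_xvRay`**, **`opBC_xvRay`**), and `⟪c·e_xv, targetBiv S⟫ = (1−q)·c·S_xv ≥ 0` (**`pcell2_rayA_nonneg`**);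
* the columns follow by the mirror identity `pcell2_mirror` (**`pcell2_col_rayA_nonneg`**, **`pcell2_col_rayD_nonneg`**).
Hence (**`partsOK_of_core`**) the parts condition of any word reduces to the 25 CORE pairs `(P,S) ∈ {AC, BD, 𝟙, R₀(w), R₁(w)}²`.
[cite: Grimmett2006, §3.9 eq. (3.94) (pp. 63–64)] [folklore]
-/

noncomputable section

namespace Summit.CriticalPhenomena.PercolationContinuityZ3.Theorems

namespace FK

namespace ThreeApex

/-! ### The row `D`: the input bivector of `D` is the seed `e_zv` -/

section RowD

variable {q : ℝ} {k0 k1 k2 : ℕ} {x1 y1 x2 y2 : ℝ}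

/-- `inputBiv D = e_zv`. [folklore] -/
theorem inputBiv_rayD : inputBiv rayD = bivZV := by
  ext <;> simp [inputBiv, rayD, bivZV]

/-- **The row `D` is free**: `pcell2 … D S ≥ 0` for every rim word, every spoke pattern in `[0,1]⁴`, every target generator `S` and every
`q ∈ [0,1]`. [folklore] -/
theorem pcell2_rayD_nonneg (hq0 : 0 ≤ q) (hq1 : q ≤ 1) (hx10 : 0 ≤ x1) (hx11 : x1 ≤ 1) (hy10 : 0 ≤ y1) (hy11 : y1 ≤ 1)
    (hx20 : 0 ≤ x2) (hx21 : x2 ≤ 1) (hy20 : 0 ≤ y2) (hy21 : y2 ≤ 1) {S : P6} (hS : IsGenP q S) :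
    0 ≤ pcell2 q k0 k1 k2 x1 y1 x2 y2 rayD S := by
  unfold pcell2
  rw [inputBiv_rayD]
  exact pairH_seedCone_targetBiv_nonneg hq0 hq1
    (seedCone_rimOp_mem hq0 k2 (seedCone_opAC_mem hq0 hx20 hx21 (seedCone_opBC_mem hq0 hy20 hy21
      (seedCone_rimOp_mem hq0 k1 (seedCone_opAC_mem hq0 hx10 hx11 (seedCone_opBC_mem hq0 hy10 hy11
        (seedCone_rimOp_mem hq0 k0 (bivZV_mem_seedCone q)))))))) hS

end RowD

/-! ### The row `A`: the channel `ℝ·e_xv` -/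

section RowA

variable {q : ℝ} {k0 k1 k2 : ℕ} {x1 y1 x2 y2 : ℝ}

/-- The rim letters scale `e_xv = inputBiv A` by a non-negative factor (`0`, `q`, `1`). [folklore] -/
theorem rimOp_xvRay (hq0 : 0 ≤ q) (k : ℕ) {c : ℝ} (hc : 0 ≤ c) :
    ∃ c', 0 ≤ c' ∧ rimOp q k (Biv.smul c (inputBiv rayA)) = Biv.smul c' (inputBiv rayA) := by
  match k with
  | 0 => exact ⟨0, le_rfl, by ext <;> simp [rimOp, opWD, formD, Biv.smul, inputBiv, rayA]⟩
  | 1 => exact ⟨q * c, mul_nonneg hq0 hc, by ext <;> simp only [rimOp, opTD, Biv.smul, inputBiv, rayA] <;> ring⟩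
  | _ + 2 => exact ⟨c, hc, rfl⟩

/-- `∧²AC_x` scales `e_xv` by `1 − x`. [folklore] -/
theorem opAC_xvRay {x : ℝ} (hx1 : x ≤ 1) {c : ℝ} (hc : 0 ≤ c) :
    ∃ c', 0 ≤ c' ∧ opAC x (Biv.smul c (inputBiv rayA)) = Biv.smul c' (inputBiv rayA) :=
  ⟨(1 - x) * c, mul_nonneg (sub_nonneg.2 hx1) hc, by
    ext <;> simp only [opAC, opTa, opWa, Biv.lin3, Biv.add, Biv.smul, inputBiv, rayA] <;> ring⟩

/-- `∧²BC_y` scales `e_xv` by `1 − y`. [folklore] -/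
theorem opBC_xvRay {y : ℝ} (hy1 : y ≤ 1) {c : ℝ} (hc : 0 ≤ c) :
    ∃ c', 0 ≤ c' ∧ opBC y (Biv.smul c (inputBiv rayA)) = Biv.smul c' (inputBiv rayA) :=
  ⟨(1 - y) * c, mul_nonneg (sub_nonneg.2 hy1) hc, by
    ext <;> simp only [opBC, opTb, opWb, Biv.lin3, Biv.add, Biv.smul, inputBiv, rayA] <;> ring⟩

/-- `⟪c·e_xv, targetBiv S⟫ = (1−q)·c·S_xv`. [folklore] -/
theorem pairH_smul_inputBiv_rayA_targetBiv (q c : ℝ) (S : P6) :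
    pairH q (Biv.smul c (inputBiv rayA)) (targetBiv S) = (1 - q) * c * S.xv := by
  simp only [pairH, Biv.smul, inputBiv, targetBiv, rayA]; ring

/-- Every parts generator has `S_xv ≥ 0` (`q ≤ 1`). [folklore] -/
theorem xv_nonneg_of_isGenP (hq1 : q ≤ 1) {S : P6} (hS : IsGenP q S) : 0 ≤ S.xv := by
  have h2q : 0 ≤ 2 - q := by linarith
  rcases hS with rfl | rfl | rfl | rfl | rfl | ⟨w, hw0, hw1, rfl | rfl⟩
  · simp [rayA]
  · simp [rayD]
  · simp [rayAC]
  · simp [rayBD]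
  · simp [rayOne]
  · have hw1' : 0 ≤ 1 - w := sub_nonneg.2 hw1
    have hq' : 0 ≤ 2 - q - q * w := by nlinarith
    simp only [roofR0, xwR]
    nlinarith [mul_nonneg hw0 hw1', mul_nonneg hw1' hq']
  · have hw1' : 0 ≤ 1 - w := sub_nonneg.2 hw1
    have hq' : 0 ≤ 2 - q - q * w := by nlinarith
    simp only [roofR1, xwR]
    nlinarith [mul_nonneg hw0 hw1', mul_nonneg hw1' hq']

/-- **The row `A` is free**: `pcell2 … A S ≥ 0` for every rim word, every spoke pattern with weights `≤ 1`, every target generator `S`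
and `0 ≤ q ≤ 1`. [folklore] -/
theorem pcell2_rayA_nonneg (hq0 : 0 ≤ q) (hq1 : q ≤ 1) (hx11 : x1 ≤ 1) (hy11 : y1 ≤ 1) (hx21 : x2 ≤ 1) (hy21 : y2 ≤ 1) {S : P6}
    (hS : IsGenP q S) : 0 ≤ pcell2 q k0 k1 k2 x1 y1 x2 y2 rayA S := by
  unfold pcell2
  have h0 : inputBiv rayA = Biv.smul 1 (inputBiv rayA) := by ext <;> simp [Biv.smul]
  rw [h0]
  obtain ⟨c1, hc1, e1⟩ := rimOp_xvRay hq0 k0 (zero_le_one : (0:ℝ) ≤ 1)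
  rw [e1]
  obtain ⟨c2, hc2, e2⟩ := opBC_xvRay hy11 hc1
  rw [e2]
  obtain ⟨c3, hc3, e3⟩ := opAC_xvRay hx11 hc2
  rw [e3]
  obtain ⟨c4, hc4, e4⟩ := rimOp_xvRay hq0 k1 hc3
  rw [e4]
  obtain ⟨c5, hc5, e5⟩ := opBC_xvRay hy21 hc4
  rw [e5]
  obtain ⟨c6, hc6, e6⟩ := opAC_xvRay hx21 hc5
  rw [e6]
  obtain ⟨c7, hc7, e7⟩ := rimOp_xvRay hq0 k2 hc6
  rw [e7, pairH_smul_inputBiv_rayA_targetBiv]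
  exact mul_nonneg (mul_nonneg (sub_nonneg.2 hq1) hc7) (xv_nonneg_of_isGenP hq1 hS)

end RowA

/-! ### The columns `A` and `D`, and the reduction to the core -/

section Core

variable {q : ℝ} {k0 k1 k2 : ℕ} {x1 y1 x2 y2 : ℝ}

/-- **The column `A` is free** (mirror of the row). [folklore] -/
theorem pcell2_col_rayA_nonneg (hq0 : 0 ≤ q) (hq1 : q ≤ 1) (hx11 : x1 ≤ 1) (hy11 : y1 ≤ 1) (hx21 : x2 ≤ 1) (hy21 : y2 ≤ 1)
    {P : P6} (hP : IsGenP q P) : 0 ≤ pcell2 q k0 k1 k2 x1 y1 x2 y2 P rayA := by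
  rw [pcell2_mirror]
  exact pcell2_rayA_nonneg hq0 hq1 hy21 hx21 hy11 hx11 hP

/-- **The column `D` is free** (mirror of the row). [folklore] -/
theorem pcell2_col_rayD_nonneg (hq0 : 0 ≤ q) (hq1 : q ≤ 1) (hx10 : 0 ≤ x1) (hx11 : x1 ≤ 1) (hy10 : 0 ≤ y1) (hy11 : y1 ≤ 1)
    (hx20 : 0 ≤ x2) (hx21 : x2 ≤ 1) (hy20 : 0 ≤ y2) (hy21 : y2 ≤ 1) {P : P6} (hP : IsGenP q P) :
    0 ≤ pcell2 q k0 k1 k2 x1 y1 x2 y2 P rayD := by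
  rw [pcell2_mirror]
  exact pcell2_rayD_nonneg hq0 hq1 hy20 hy21 hx20 hx21 hy10 hy11 hx10 hx11 hP

/-- **Reduction to the core**: the parts condition of ANY rim word follows from its 25 core pairs
`(P,S) ∈ {AC, BD, 𝟙, R₀(w), R₁(w)}²` (`q ∈ [0,1]`, spokes in `[0,1]`). [folklore] -/
theorem partsOK_of_core (hq0 : 0 ≤ q) (hq1 : q ≤ 1) (hx10 : 0 ≤ x1) (hx11 : x1 ≤ 1) (hy10 : 0 ≤ y1) (hy11 : y1 ≤ 1)
    (hx20 : 0 ≤ x2) (hx21 : x2 ≤ 1) (hy20 : 0 ≤ y2) (hy21 : y2 ≤ 1)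
    (h : ∀ P S : P6, IsGenP q P → IsGenP q S → P ≠ rayA → P ≠ rayD → S ≠ rayA → S ≠ rayD →
      0 ≤ pcell2 q k0 k1 k2 x1 y1 x2 y2 P S) :
    PartsOK q k0 k1 k2 x1 y1 x2 y2 := by
  intro P S hP hS
  by_cases hPA : P = rayA
  · subst hPA; exact pcell2_rayA_nonneg hq0 hq1 hx11 hy11 hx21 hy21 hS
  by_cases hPD : P = rayD
  · subst hPD; exact pcell2_rayD_nonneg hq0 hq1 hx10 hx11 hy10 hy11 hx20 hx21 hy20 hy21 hS
  by_cases hSA : S = rayA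
  · subst hSA; exact pcell2_col_rayA_nonneg hq0 hq1 hx11 hy11 hx21 hy21 hP
  by_cases hSD : S = rayD
  · subst hSD; exact pcell2_col_rayD_nonneg hq0 hq1 hx10 hx11 hy10 hy11 hx20 hx21 hy20 hy21 hP
  exact h P S hP hS hPA hPD hSA hSD

end Core

end ThreeApex

end FK

end Summit.CriticalPhenomena.PercolationContinuityZ3.Theorems
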